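import Mathlib.MeasureTheory.Integral.IntervalIntegral.Periodic
import Literature.Analysis.FluidPDE.TorusSpaceTimeCutoff
import Literature.MeasureTheory.Hausdorff.BallGrowthAbsCont
import Literature.Barriers.AnomalousDissipation.DissipationSupportLowerBound
import HarnessLib

/-!
# Proof of the De Rosa–Drivas–Inversi barriers `DeRosaDrivasInversi2024_thm12_bounded` and
`DeRosaDrivasInversi2024_thm19_bounded`

Discharge (`theorem DeRosaDrivasInversi2024_thm12_bounded_holds`) of the named fact of
`Literature/Barriers/AnomalousDissipation/DissipationSupportLowerBound.lean`: for a bounded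
distributional Euler pair `(u, p)` on `T^d × (0,T)` whose local energy balance holds with a
non-negative, locally finite dissipation measure `μ`, the restriction of `μ` to the open slab is
absolutely continuous with respect to the `d`-dimensional Hausdorff measure of the space–time
`ℝ × T^d` (L. De Rosa, T. D. Drivas, M. Inversi, *On the support of anomalous dissipation
measures*, J. Math. Fluid Mech. 26 (2024), arXiv:2301.09603, Thm. 1.2 with `r = q = ∞`, `s = d`,
`α = 1`).

## The printed proof and its formalisation

Thm. 1.2 is the case `α = α_opt` of op. cit. Thm. 3.1, itself "a direct consequence" (op. cit.
§3) of the cylinder estimate Prop. 3.2 and of the covering Lemma 2.3 / Cor. 2.4: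

* **Prop. 3.2 (cylinder estimate), bounded case** — `cylinder_estimate`: fix a compact time
  window `[δ, T-δ]`; for `(t, x)` in it and `r ≤ min(δ/4, 1/(8d))`, test the local energy
  balance (op. cit. (1.4)) with the product cutoff `ψ = η_r(· - t) χ(x - ·)` of
  `FluidPDE/TorusSpaceTimeCutoff` (`η_r = 1` on `|s - t| ≤ r`, `= 0` off `|s - t| < 2r`,
  `|η'_r| ≤ B₁/r`; `χ = 1` on the torus ball of radius `r`, `= 0` off radius `2dr`,
  `‖∇χ‖ ≤ B/r`). Since `μ ≥ 0` and `ψ = 1` on the closed space–time ball `B̄((t,x), r)` (sup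
  metric of `ℝ × T^d`), `μ(B̄((t,x), r)) ≤ ∫ ψ dμ = ∫∫ [½|u|² ∂ₜψ + (½|u|² + p) u·∇ψ]`
  (the terms `I_δ + II_δ + III_δ` of op. cit.), and with `|u| ≤ M`, `|p| ≤ P` a.e. the
  integrand is `≤ K₀/r`, `K₀ = ½M²B₁ + (½M² + P)MB`, and vanishes off
  `[t-2r, t+2r] × B̄(x, 2dr)`, a set of volume `≤ 4r (4dr)^d`; hence
  `μ(B̄((t,x), r)) ≤ 4K₀(4d)^d r^d` (op. cit. (3.2)–(3.5) with `r = q = ∞`).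
* **Lemma 2.3 (covering)** — `Literature.MeasureTheory.Hausdorff.
  absolutelyContinuous_restrict_hausdorffMeasure_of_closedBall_le` (mass distribution
  principle, Mathlib `Measure.le_hausdorffMeasure`): the uniform ball growth on
  `K_δ = [δ, T-δ] × T^d` gives `μ|_{K_δ} ≪ μH[d]`.
* **Exhaustion** — `(0,T) × T^d = ⋃ₙ K_{T/(n+2)}`, so `μ|_{(0,T) × T^d} ≪ μH[d]`.

As in the printed proof only the local energy balance and the bounds on `u`, `p` are used; the
Euler equations themselves (hypothesis `hsol` of the fact) play no role in the bounded case.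

The metric on `ℝ × T^d` is Mathlib's product (sup) metric, whose balls are exactly the
cylinders `𝒞¹_δ(x,t) = B_δ(x) × (t-δ, t+δ)` of op. cit. §2.1 (up to open/closed), so `μH[d]`
there is the isotropic `𝓗^d = 𝓗^d_1` of op. cit. Def. 2.1 up to the normalisation constant of
the Carathéodory construction, which does not affect null sets.

The last section discharges the divergence-measure form `DeRosaDrivasInversi2024_thm19_bounded`
(op. cit. Thm. 1.9 with `r = ∞` and the bounded source term of App. B, (B.1) with `l = m = ∞`):
`cylinder_estimate_div` is the same cylinder estimate for a bounded triple `(e, Q, g)` with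
`∂ₜ e + div Q + μ = g` in `𝒟'((0,T) × T^d)` (integrand `e ∂ₜψ + ⟪Q, ∇ψ⟫ + g ψ`, bounded by
`(Me B₁ + MQ B + Mg)/r` on the support of `ψ`; op. cit. Rem. 2.7), and
`DeRosaDrivasInversi2024_thm19_bounded_holds` follows by the same covering lemma and the
exhaustion of `(0,T)` by the windows `[1/(n+1), T - 1/(n+1)]` (no sign condition on `T` is
needed).

## References

* L. De Rosa, T. D. Drivas, M. Inversi, J. Math. Fluid Mech. 26 (2024), arXiv:2301.09603:
  Thm. 1.2, Rem. 1.3, Thm. 1.9, §2.1 (Def. 2.1, Lemma 2.3, Cor. 2.4), §2.2 (Thm. 2.6, Rem. 2.7),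
  §3 (Thm. 3.1, Prop. 3.2 and its proof, (3.2)–(3.5)), App. B ((B.1)–(B.2)).
* P. Mattila, *Geometry of sets and measures in Euclidean spaces* (1995), Thm. 8.8.
-/

noncomputable section

open MeasureTheory Set Filter Metric Function
open scoped ENNReal NNReal InnerProductSpace RealInnerProductSpace Topology

namespace Literature.Barriers.AnomalousDissipation

open Literature.Analysis Literature.Analysis.FluidPDE

/-! ## Volumes of balls in `T^d` -/

/-- The Haar probability measure of a closed ball of radius `ρ ≥ 0` in the flat torus
`T^d = (ℝ/ℤ)^d` (sup metric) is at most `(2ρ)^d`: the ball is the product of `d` arcs of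
length `min(1, 2ρ)` (Mathlib `volume_pi_closedBall`, `AddCircle.volume_closedBall`). [folklore] -/
theorem volume_real_closedBall_unitAddTorus_le {d : Type*} [Fintype d] (x : UnitAddTorus d)
    {ρ : ℝ} (hρ : 0 ≤ ρ) : volume.real (closedBall x ρ) ≤ (2 * ρ) ^ Fintype.card d := by
  rw [measureReal_def, volume_pi_closedBall x hρ, ENNReal.toReal_prod]
  calc ∏ i, (volume (closedBall (x i) ρ)).toReal ≤ ∏ _i : d, (2 * ρ) := by
        refine Finset.prod_le_prod (fun i _ => ENNReal.toReal_nonneg) fun i _ => ?_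
        rw [AddCircle.volume_closedBall, ENNReal.toReal_ofReal (le_min zero_le_one (by positivity))]
        exact min_le_right _ _
    _ = (2 * ρ) ^ Fintype.card d := by rw [Finset.prod_const, Finset.card_univ]

/-! ## Prop. 3.2: the cylinder estimate in the bounded case -/

/-- **The cylinder estimate (De Rosa–Drivas–Inversi 2024, Prop. 3.2, case `r = q = ∞`).**
Let `(u, p)` satisfy the local energy balance on `(0,T) × T^d` with `ν = 0` and dissipation the
non-negative measure `μ`, finite on `[δ/2, T-δ/2] × T^d`, and let `|u| ≤ M`, `|p| ≤ P` a.e.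
there. Then there is `C` such that `μ(B̄((t,x), r)) ≤ C r^d` for every `(t, x)` with
`t ∈ [δ, T-δ]` and every `0 < r ≤ min(δ/4, 1/(8d))` (closed balls of the sup metric on
`ℝ × T^d`, i.e. the space–time cylinders `𝒞¹_r`): test the balance with the product cutoff
`ψ = η_r(· - t) χ(x - ·)` (`FluidPDE/TorusSpaceTimeCutoff`), use `μ ≥ 0`, `ψ = 1` on the ball,
`|∂ₜψ|, |∇ψ| ≲ r⁻¹` and `|supp ψ| ≲ r^{d+1}` (op. cit. (3.2)–(3.5)). In fact
`C = 4K₀(4d)^d`, `K₀ = ½M²B₁ + (½M² + P)MB` with the cutoff constants `B₁`, `B`. [cite: DeRosaDrivasInversi2024, Prop. 3.2] -/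
theorem cylinder_estimate {d : Type*} [Fintype d] [DecidableEq d] (hd : 1 ≤ Fintype.card d)
    {T : ℝ} {u : ℝ → UnitAddTorus d → EuclideanSpace ℝ d} {p : ℝ → UnitAddTorus d → ℝ}
    {μ : Measure (ℝ × UnitAddTorus d)} {δ M P : ℝ} (hM : 0 ≤ M) (hP : 0 ≤ P)
    (hu : ∀ᵐ z ∂(volume.restrict (Icc (δ / 2) (T - δ / 2) ×ˢ univ)), ‖u z.1 z.2‖ ≤ M)
    (hp : ∀ᵐ z ∂(volume.restrict (Icc (δ / 2) (T - δ / 2) ×ˢ univ)), |p z.1 z.2| ≤ P)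
    (hμ : μ (Icc (δ / 2) (T - δ / 2) ×ˢ univ) < ∞)
    (hbal : Torus.HasLocalEnergyBalance T 0 u p 0 (Torus.STFunctional.ofMeasure μ)) :
    ∃ C : ℝ, ∀ z ∈ Icc δ (T - δ) ×ˢ (univ : Set (UnitAddTorus d)), ∀ r : ℝ, 0 < r →
      r ≤ min (δ / 4) (1 / (8 * Fintype.card d)) →
        μ (closedBall z r) ≤ ENNReal.ofReal (C * r ^ Fintype.card d) := by
  obtain ⟨B, hB0, hB⟩ := exists_norm_fderiv_radialCutoff_two_mul_le (EuclideanSpace ℝ d)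
  obtain ⟨B₁, hB₁0, hB₁⟩ := exists_norm_fderiv_radialCutoff_two_mul_le ℝ
  set c : ℕ := Fintype.card d with hc
  have hc1 : (1 : ℝ) ≤ c := by exact_mod_cast hd
  have hcpos : (0 : ℝ) < c := by linarith
  -- the a.e. bounds in iterated form
  have hae : ∀ᵐ t ∂(volume.restrict (Icc (δ / 2) (T - δ / 2))),
      ∀ᵐ x ∂(volume : Measure (UnitAddTorus d)), ‖u t x‖ ≤ M ∧ |p t x| ≤ P := by
    have h2 : ∀ᵐ z ∂(volume.restrict (Icc (δ / 2) (T - δ / 2) ×ˢ (univ : Set (UnitAddTorus d)))),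
        ‖u z.1 z.2‖ ≤ M ∧ |p z.1 z.2| ≤ P := hu.and hp
    have hpr := Measure.prod_restrict (μ := (volume : Measure ℝ))
      (ν := (volume : Measure (UnitAddTorus d))) (Icc (δ / 2) (T - δ / 2)) (univ : Set (UnitAddTorus d))
    rw [Measure.restrict_univ] at hpr
    rw [Measure.volume_eq_prod, ← hpr] at h2
    exact Measure.ae_ae_of_ae_prod h2
  set K₀ : ℝ := 2⁻¹ * M ^ 2 * B₁ + (2⁻¹ * M ^ 2 + P) * M * B with hK₀
  have hK₀nn : 0 ≤ K₀ := by positivity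
  refine ⟨4 * K₀ * (4 * c) ^ c, ?_⟩
  rintro ⟨t₀, x₀⟩ hz r hr hrle
  obtain ⟨ht₀, -⟩ := mem_prod.1 hz
  rw [mem_Icc] at ht₀
  have hrδ : r ≤ δ / 4 := hrle.trans (min_le_left _ _)
  have hrc : r ≤ 1 / (8 * c) := hrle.trans (min_le_right _ _)
  have hr0 : r ≠ 0 := hr.ne'
  -- the spatial scale `R = d r`
  set R : ℝ := c * r with hR
  have hRpos : 0 < R := mul_pos hcpos hr
  have hR8 : R ≤ 1 / 8 := by
    have h := mul_le_mul_of_nonneg_left hrc hcpos.le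
    have h2 : (c : ℝ) * (1 / (8 * c)) = 1 / 8 := by field_simp
    rw [h2] at h
    exact h
  have hrR : r ≤ R := le_mul_of_one_le_left hr.le hc1
  have h0t : 2 * r < t₀ := by linarith [ht₀.1]
  have hTt : t₀ + 2 * r < T := by linarith [ht₀.2]
  have hS : Icc (t₀ - 2 * r) (t₀ + 2 * r) ⊆ Ioo 0 T := fun t ht => ⟨by linarith [ht.1], by linarith [ht.2]⟩
  have hS' : Icc (t₀ - 2 * r) (t₀ + 2 * r) ⊆ Icc (δ / 2) (T - δ / 2) := fun t ht =>
    ⟨by linarith [ht.1, ht₀.1], by linarith [ht.2, ht₀.2]⟩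
  -- the cutoffs
  set Θ : UnitAddTorus d → ℝ :=
    FunctionSpaces.Torus.transplant (radialCutoff R (2 * R) : EuclideanSpace ℝ d → ℝ) with hΘ
  set η : ℝ → ℝ := fun t => radialCutoff r (2 * r) (t - t₀) with hη
  set ψ : ℝ → UnitAddTorus d → ℝ := fun t y => η t * Θ (x₀ - y) with hψ
  have hΘs : FunctionSpaces.Torus.IsSmooth Θ := isSmooth_transplant_radialCutoff hRpos hR8
  have hΘ1 : FunctionSpaces.Torus.IsContDiff 1 Θ := hΘs.isContDiff (by simp)
  have hψtest : FunctionSpaces.Torus.IsSpaceTimeTestIoo T ψ :=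
    isSpaceTimeTestIoo_radialCutoff_mul_comp_sub hr h0t hTt hΘs x₀
  have hderiv : ∀ t y, FunctionSpaces.Torus.timeDeriv ψ t y = deriv η t * Θ (x₀ - y) :=
    fun t y => Torus.timeDeriv_mul_comp_sub η Θ x₀ t y
  have hgrad : ∀ t y, FunctionSpaces.Torus.gradient (ψ t) y =
      -(η t • FunctionSpaces.Torus.gradient Θ (x₀ - y)) :=
    fun t y => Torus.gradient_mul_comp_sub hΘ1 x₀ t y
  have hη01 : ∀ t, 0 ≤ η t ∧ η t ≤ 1 := fun t => ⟨radialCutoff_nonneg _ _ _, radialCutoff_le_one _ _ _⟩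
  have hΘ01 : ∀ z, 0 ≤ Θ z ∧ Θ z ≤ 1 := fun z => ⟨radialCutoff_nonneg _ _ _, radialCutoff_le_one _ _ _⟩
  have hηabs : ∀ t, |η t| ≤ 1 := fun t => by
    rw [abs_of_nonneg (hη01 t).1]
    exact (hη01 t).2
  have hΘabs : ∀ z, |Θ z| ≤ 1 := fun z => by
    rw [abs_of_nonneg (hΘ01 z).1]
    exact (hΘ01 z).2
  have hB₁' : ∀ t, |deriv η t| ≤ B₁ / r := abs_deriv_radialCutoff_sub_le (hB₁ r hr)
  have hgradΘ : ∀ z, ‖FunctionSpaces.Torus.gradient Θ z‖ ≤ B / R :=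
    norm_gradient_transplant_radialCutoff_le hRpos hR8 (hB R hRpos)
  -- the integrand of the local energy balance at `ν = 0`
  set F : ℝ → UnitAddTorus d → ℝ := fun t x =>
    2⁻¹ * ‖u t x‖ ^ 2 * FunctionSpaces.Torus.timeDeriv ψ t x +
      (2⁻¹ * ‖u t x‖ ^ 2 + p t x) * ⟪u t x, FunctionSpaces.Torus.gradient (ψ t) x⟫_ℝ with hF
  have hid : ∫ t in Ioo 0 T, ∫ x, F t x = ∫ z, ψ z.1 z.2 ∂μ := by
    have h := hbal.2 ψ hψtest
    simp only [mul_zero, zero_mul, add_zero, sub_zero] at h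
    exact h
  -- localisation of the integrand
  have hF0_time : ∀ t, 2 * r < |t - t₀| → ∀ x, F t x = 0 := by
    intro t ht x
    have h1 : η t = 0 := radialCutoff_sub_eq_zero hr ht.le
    have h2 : deriv η t = 0 := deriv_radialCutoff_sub_eq_zero hr ht
    simp only [hF, hderiv t x, hgrad t x, h1, h2, zero_mul, zero_smul, neg_zero, inner_zero_right,
      mul_zero, add_zero]
  have hF0_space : ∀ t x, 2 * R < ‖x₀ - x‖ → F t x = 0 := by
    intro t x hx
    have h1 : Θ (x₀ - x) = 0 := transplant_radialCutoff_eq_zero hRpos hx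
    have h2 : FunctionSpaces.Torus.gradient Θ (x₀ - x) = 0 :=
      gradient_transplant_radialCutoff_eq_zero hRpos hR8 hx
    simp only [hF, hderiv t x, hgrad t x, h1, h2, mul_zero, smul_zero, neg_zero, inner_zero_right,
      add_zero]
  -- the pointwise bound where `u`, `p` are bounded
  have hFbd : ∀ t x, ‖u t x‖ ≤ M → |p t x| ≤ P → ‖F t x‖ ≤ K₀ / r := by
    intro t x hux hpx
    have hdt : |FunctionSpaces.Torus.timeDeriv ψ t x| ≤ B₁ / r := by
      rw [hderiv, abs_mul]
      calc |deriv η t| * |Θ (x₀ - x)| ≤ B₁ / r * 1 :=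
            mul_le_mul (hB₁' t) (hΘabs _) (abs_nonneg _) (by positivity)
        _ = B₁ / r := mul_one _
    have hgr : ‖FunctionSpaces.Torus.gradient (ψ t) x‖ ≤ B / r := by
      rw [hgrad, norm_neg, norm_smul, Real.norm_eq_abs]
      calc |η t| * ‖FunctionSpaces.Torus.gradient Θ (x₀ - x)‖ ≤ 1 * (B / R) :=
            mul_le_mul (hηabs t) (hgradΘ _) (norm_nonneg _) zero_le_one
        _ = B / R := one_mul _
        _ ≤ B / r := div_le_div_of_nonneg_left hB0 hr hrR
    have hu2 : ‖u t x‖ ^ 2 ≤ M ^ 2 := pow_le_pow_left₀ (norm_nonneg _) hux 2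
    have hin : |⟪u t x, FunctionSpaces.Torus.gradient (ψ t) x⟫_ℝ| ≤ M * (B / r) :=
      (abs_real_inner_le_norm _ _).trans (mul_le_mul hux hgr (norm_nonneg _) hM)
    have hco : |2⁻¹ * ‖u t x‖ ^ 2 + p t x| ≤ 2⁻¹ * M ^ 2 + P :=
      (abs_add_le _ _).trans (add_le_add (by rw [abs_of_nonneg (by positivity)]; linarith) hpx)
    rw [Real.norm_eq_abs]
    calc |F t x| ≤ |2⁻¹ * ‖u t x‖ ^ 2 * FunctionSpaces.Torus.timeDeriv ψ t x| +
          |(2⁻¹ * ‖u t x‖ ^ 2 + p t x) * ⟪u t x, FunctionSpaces.Torus.gradient (ψ t) x⟫_ℝ| :=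
          abs_add_le _ _
      _ = 2⁻¹ * ‖u t x‖ ^ 2 * |FunctionSpaces.Torus.timeDeriv ψ t x| +
          |2⁻¹ * ‖u t x‖ ^ 2 + p t x| * |⟪u t x, FunctionSpaces.Torus.gradient (ψ t) x⟫_ℝ| := by
          rw [abs_mul (2⁻¹ * ‖u t x‖ ^ 2), abs_mul (2⁻¹ * ‖u t x‖ ^ 2 + p t x),
            abs_of_nonneg (by positivity : (0 : ℝ) ≤ 2⁻¹ * ‖u t x‖ ^ 2)]
      _ ≤ 2⁻¹ * M ^ 2 * (B₁ / r) + (2⁻¹ * M ^ 2 + P) * (M * (B / r)) :=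
          add_le_add (mul_le_mul (by linarith) hdt (abs_nonneg _) (by positivity))
            (mul_le_mul hco hin (abs_nonneg _) (by positivity))
      _ = K₀ / r := by
          rw [hK₀]
          ring
  -- the space integral at a time where the bounds hold
  have hinner : ∀ t, (∀ᵐ x ∂(volume : Measure (UnitAddTorus d)), ‖u t x‖ ≤ M ∧ |p t x| ≤ P) →
      ‖∫ x, F t x‖ ≤ K₀ / r * (4 * R) ^ c := by
    intro t ht
    have hvan : ∀ x, x ∉ closedBall x₀ (2 * R) → F t x = 0 := fun x hx =>
      hF0_space t x (by rwa [mem_closedBall, not_le, dist_comm, dist_eq_norm] at hx)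
    rw [← setIntegral_eq_integral_of_forall_compl_eq_zero hvan]
    calc ‖∫ x in closedBall x₀ (2 * R), F t x‖ ≤ K₀ / r * volume.real (closedBall x₀ (2 * R)) :=
          norm_setIntegral_le_of_norm_le_const_ae (measure_lt_top _ _)
            (ae_restrict_of_ae (ht.mono fun x hx => hFbd t x hx.1 hx.2))
      _ ≤ K₀ / r * (2 * (2 * R)) ^ c :=
          mul_le_mul_of_nonneg_left (volume_real_closedBall_unitAddTorus_le x₀ (by positivity))
            (by positivity)
      _ = K₀ / r * (4 * R) ^ c := by ring
  -- the space–time integral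
  have htime : ∫ t in Ioo 0 T, ∫ x, F t x = ∫ t in Icc (t₀ - 2 * r) (t₀ + 2 * r), ∫ x, F t x := by
    refine setIntegral_eq_of_subset_of_forall_sdiff_eq_zero measurableSet_Ioo hS fun t ht => ?_
    have h2 : 2 * r < |t - t₀| := by
      have h' : t ∉ Icc (t₀ - 2 * r) (t₀ + 2 * r) := ht.2
      rw [mem_Icc, not_and_or, not_le, not_le] at h'
      rcases h' with h' | h'
      · rw [abs_of_neg (by linarith)]
        linarith
      · rw [abs_of_pos (by linarith)]
        linarith
    simp only [hF0_time t h2, integral_zero]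
  have hup : ∫ t in Ioo 0 T, ∫ x, F t x ≤ 4 * K₀ * (4 * c) ^ c * r ^ c := by
    rw [htime]
    calc ∫ t in Icc (t₀ - 2 * r) (t₀ + 2 * r), ∫ x, F t x
        ≤ ‖∫ t in Icc (t₀ - 2 * r) (t₀ + 2 * r), ∫ x, F t x‖ := Real.le_norm_self _
      _ ≤ K₀ / r * (4 * R) ^ c * volume.real (Icc (t₀ - 2 * r) (t₀ + 2 * r)) :=
          norm_setIntegral_le_of_norm_le_const_ae measure_Icc_lt_top
            ((ae_restrict_of_ae_restrict_of_subset hS' hae).mono fun t ht => hinner t ht)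
      _ = 4 * K₀ * (4 * c) ^ c * r ^ c := by
          rw [Real.volume_real_Icc_of_le (by linarith), hR]
          field_simp
          ring
  -- `μ ≥ 0` and `ψ = 1` on the ball: the lower bound
  have hcont : Continuous fun z : ℝ × UnitAddTorus d => ψ z.1 z.2 :=
    continuous_radialCutoff_mul_comp_sub r t₀ hΘs.continuous x₀
  have hψ01 : ∀ t y, 0 ≤ ψ t y ∧ ψ t y ≤ 1 := fun t y =>
    ⟨mul_nonneg (hη01 t).1 (hΘ01 _).1, mul_le_one₀ (hη01 t).2 (hΘ01 _).1 (hΘ01 _).2⟩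
  have hsupp : support (fun z : ℝ × UnitAddTorus d => ψ z.1 z.2) ⊆
      Icc (δ / 2) (T - δ / 2) ×ˢ univ := by
    intro z hz
    refine ⟨hS' ?_, mem_univ _⟩
    have hne : η z.1 ≠ 0 := fun h => hz (by
      show η z.1 * Θ (x₀ - z.2) = 0
      rw [h, zero_mul])
    exact support_radialCutoff_sub_subset hr hne
  have hint : Integrable (fun z : ℝ × UnitAddTorus d => ψ z.1 z.2) μ := by
    refine (integrableOn_iff_integrable_of_support_subset hsupp).1 ?_
    exact Measure.integrableOn_of_bounded (M := 1) hμ.ne hcont.aestronglyMeasurable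
      (ae_of_all _ fun z => by
        rw [Real.norm_eq_abs, abs_of_nonneg (hψ01 _ _).1]
        exact (hψ01 _ _).2)
  have hball_one : ∀ z ∈ closedBall ((t₀, x₀) : ℝ × UnitAddTorus d) r, ψ z.1 z.2 = 1 := by
    rintro ⟨t, y⟩ hzb
    rw [mem_closedBall, Prod.dist_eq, max_le_iff] at hzb
    obtain ⟨ht, hy⟩ := hzb
    show η t * Θ (x₀ - y) = 1
    have h1 : η t = 1 := radialCutoff_sub_eq_one hr (by rwa [← Real.dist_eq])
    have h2 : Θ (x₀ - y) = 1 := by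
      refine transplant_radialCutoff_eq_one hRpos ?_
      rw [← dist_eq_norm, dist_comm]
      exact mul_le_mul_of_nonneg_left hy hcpos.le
    rw [h1, h2, one_mul]
  have hlow : μ.real (closedBall ((t₀, x₀) : ℝ × UnitAddTorus d) r) ≤ ∫ z, ψ z.1 z.2 ∂μ := by
    calc μ.real (closedBall ((t₀, x₀) : ℝ × UnitAddTorus d) r)
        = ∫ z, (closedBall ((t₀, x₀) : ℝ × UnitAddTorus d) r).indicator (fun _ => (1 : ℝ)) z ∂μ := by
          rw [integral_indicator_const (1 : ℝ) measurableSet_closedBall, smul_eq_mul, mul_one]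
      _ ≤ ∫ z, ψ z.1 z.2 ∂μ := by
          refine integral_mono_of_nonneg (ae_of_all _ fun z => ?_) hint (ae_of_all _ fun z => ?_)
          · exact Set.indicator_nonneg (fun _ _ => zero_le_one) _
          · show (closedBall ((t₀, x₀) : ℝ × UnitAddTorus d) r).indicator (fun _ => (1 : ℝ)) z ≤
              ψ z.1 z.2
            by_cases hzb : z ∈ closedBall ((t₀, x₀) : ℝ × UnitAddTorus d) r
            · rw [indicator_of_mem hzb, hball_one z hzb]
            · rw [indicator_of_notMem hzb]
              exact (hψ01 _ _).1
  -- conclusion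
  have hballsub : closedBall ((t₀, x₀) : ℝ × UnitAddTorus d) r ⊆ Icc (δ / 2) (T - δ / 2) ×ˢ univ := by
    rintro ⟨t, y⟩ hzb
    rw [mem_closedBall, Prod.dist_eq, max_le_iff, Real.dist_eq] at hzb
    have ht := abs_le.1 hzb.1
    exact ⟨⟨by linarith [ht.1, ht₀.1], by linarith [ht.2, ht₀.2]⟩, mem_univ _⟩
  have hfin : μ (closedBall ((t₀, x₀) : ℝ × UnitAddTorus d) r) ≠ ∞ :=
    (lt_of_le_of_lt (measure_mono hballsub) hμ).ne
  calc μ (closedBall ((t₀, x₀) : ℝ × UnitAddTorus d) r)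
      = ENNReal.ofReal (μ.real (closedBall ((t₀, x₀) : ℝ × UnitAddTorus d) r)) := by
        rw [measureReal_def, ENNReal.ofReal_toReal hfin]
    _ ≤ ENNReal.ofReal (4 * K₀ * (4 * c) ^ c * r ^ c) :=
        ENNReal.ofReal_le_ofReal (hlow.trans (hid.symm.le.trans hup))

/-! ## Thm. 1.2 (bounded case): the discharge -/

/-- **Discharge of `DeRosaDrivasInversi2024_thm12_bounded`** (De Rosa–Drivas–Inversi, J. Math.
Fluid Mech. 26 (2024), arXiv:2301.09603, Thm. 1.2 with `r = q = ∞`, `s = d`, `α = 1`): the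
dissipation measure of a bounded pair `(u, p)` satisfying the local energy balance on
`(0,T) × T^d` is, restricted to the open slab, absolutely continuous with respect to the
`d`-dimensional space–time Hausdorff measure. Proof: the cylinder estimate `cylinder_estimate`
(op. cit. Prop. 3.2) on each window `[δ, T-δ]`, the covering lemma
`absolutelyContinuous_restrict_hausdorffMeasure_of_closedBall_le` (op. cit. Lemma 2.3), and
exhaustion of `(0, T)` by the windows `[T/(n+2), T - T/(n+2)]`. [cite: DeRosaDrivasInversi2024, Thm. 1.2] -/
theorem DeRosaDrivasInversi2024_thm12_bounded_holds : DeRosaDrivasInversi2024_thm12_bounded := by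
  intro d _ _ hd T hT u p _ hu hp μ hμ hbal
  have hd1 : 1 ≤ Fintype.card d := le_trans (by norm_num) hd
  -- each closed time window
  have hslab : ∀ δ : ℝ, 0 < δ →
      μ.restrict (Icc δ (T - δ) ×ˢ univ) ≪ μH[Fintype.card d] := by
    intro δ hδ
    obtain ⟨Mu, hMu⟩ := hu (δ / 2) (half_pos hδ)
    obtain ⟨Mp, hMp⟩ := hp (δ / 2) (half_pos hδ)
    have hMu' : ∀ᵐ z ∂(volume.restrict (Icc (δ / 2) (T - δ / 2) ×ˢ univ)),
        ‖u z.1 z.2‖ ≤ max Mu 0 := hMu.mono fun z hz => hz.trans (le_max_left _ _)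
    have hMp' : ∀ᵐ z ∂(volume.restrict (Icc (δ / 2) (T - δ / 2) ×ˢ univ)),
        |p z.1 z.2| ≤ max Mp 0 := hMp.mono fun z hz => hz.trans (le_max_left _ _)
    obtain ⟨C, hC⟩ := cylinder_estimate hd1 (le_max_right _ _) (le_max_right _ _) hMu' hMp'
      (hμ _ (half_pos hδ)) hbal
    have hr₀ : 0 < min (δ / 4) (1 / (8 * (Fintype.card d : ℝ))) := by
      refine lt_min (by positivity) ?_
      have : (0 : ℝ) < Fintype.card d := by exact_mod_cast lt_of_lt_of_le zero_lt_one hd1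
      positivity
    refine Literature.MeasureTheory.Hausdorff.absolutelyContinuous_restrict_hausdorffMeasure_of_closedBall_le
      μ (measurableSet_Icc.prod MeasurableSet.univ)
      (by exact_mod_cast lt_of_lt_of_le zero_lt_one hd1) (C := C) hr₀ fun z hz r hr hrr => ?_
    rw [Real.rpow_natCast]
    exact hC z hz r hr hrr
  -- exhaustion of the open slab by closed windows
  refine Measure.AbsolutelyContinuous.mk fun s hs h0 => ?_
  have hcover : Ioo 0 T ×ˢ (univ : Set (UnitAddTorus d)) ⊆
      ⋃ n : ℕ, Icc (T / (n + 2)) (T - T / (n + 2)) ×ˢ univ := by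
    rintro ⟨t, x⟩ ⟨⟨ht0, htT⟩, -⟩
    have hm : 0 < min t (T - t) := lt_min ht0 (by linarith)
    obtain ⟨n, hn⟩ := exists_nat_ge (T / min t (T - t))
    have key : T / (n + 2) ≤ min t (T - t) := by
      rw [div_le_iff₀ (by positivity)]
      have h1 := (div_le_iff₀ hm).1 hn
      nlinarith
    exact mem_iUnion.2 ⟨n, ⟨key.trans (min_le_left _ _),
      by linarith [key.trans (min_le_right _ _)]⟩, mem_univ _⟩
  refine nonpos_iff_eq_zero.1 ?_
  calc μ.restrict (Ioo 0 T ×ˢ univ) s = μ (s ∩ Ioo 0 T ×ˢ univ) := Measure.restrict_apply hs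
    _ ≤ μ (⋃ n : ℕ, s ∩ Icc (T / (n + 2)) (T - T / (n + 2)) ×ˢ univ) := by
        refine measure_mono ?_
        rw [← inter_iUnion]
        exact inter_subset_inter_right _ hcover
    _ ≤ ∑' n : ℕ, μ (s ∩ Icc (T / (n + 2)) (T - T / (n + 2)) ×ˢ univ) := measure_iUnion_le _
    _ = 0 := by
        refine ENNReal.tsum_eq_zero.2 fun n => ?_
        rw [← Measure.restrict_apply hs]
        exact hslab _ (by positivity) h0
    _ ≤ 0 := le_rfl

/-! ## Thm. 1.9 (bounded case, with the source term of App. B): the divergence-measure form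

Discharge of `DeRosaDrivasInversi2024_thm19_bounded` (added 2026-08-15): the printed argument of
op. cit. Rem. 2.7 / Prop. 3.2 run for a general bounded triple `(e, Q, g)` with
`∂ₜ e + div Q + μ = g` in `𝒟'((0,T) × T^d)` — "`μ(B_δ(x)) ≤ ∫ χ_δ dμ = -∫ V·∇χ_δ ≲ …`"
(op. cit. Rem. 2.7, here for the space–time field `V = (e, Q)` and with the bounded source `g`
of op. cit. App. B, (B.1) with `l = m = ∞`: `∫∫ g χ_δ η_δ ≲ ‖g‖_∞ δ^{d+1}`), followed by the
covering Lemma 2.3 and the exhaustion of `(0,T)` by compact windows. -/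

/-- **The cylinder estimate for divergence-measure fields (De Rosa–Drivas–Inversi 2024,
Prop. 3.2 / Rem. 2.7 with `r = ∞`, source term as in App. B (B.1), `l = m = ∞`).** Let
`e`, `Q`, `g` be bounded a.e. on `[δ/2, T-δ/2] × T^d` by `Me`, `MQ`, `Mg`, let the non-negative
measure `μ` be finite there, and let `∫₀ᵀ∫ (e ∂ₜψ + ⟪Q, ∇ψ⟫ + g ψ) = ∫ ψ dμ` for every smooth `ψ`
compactly supported in time in `(0,T)`. Then `μ(B̄((t,x), r)) ≤ C r^d` for every `(t, x)` with
`t ∈ [δ, T-δ]` and every `0 < r ≤ min(δ/4, 1/(8d))`: test with the product cutoff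
`ψ = η_r(· - t) χ(x - ·)` of `FluidPDE/TorusSpaceTimeCutoff` (`= 1` on the ball, `μ ≥ 0`), whose
integrand is `≤ (Me B₁ + MQ B + Mg)/r` a.e. and vanishes off `[t-2r, t+2r] × B̄(x, 2dr)`, a set of
volume `≤ 4r (4dr)^d`. In fact `C = 4K₀(4d)^d`, `K₀ = Me B₁ + MQ B + Mg`. [cite: DeRosaDrivasInversi2024, Prop. 3.2, Rem. 2.7 and App. B (B.1)] -/
theorem cylinder_estimate_div {d : Type*} [Fintype d] [DecidableEq d] (hd : 1 ≤ Fintype.card d)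
    {T : ℝ} {e : ℝ → UnitAddTorus d → ℝ} {Q : ℝ → UnitAddTorus d → EuclideanSpace ℝ d}
    {g : ℝ → UnitAddTorus d → ℝ}
    {μ : Measure (ℝ × UnitAddTorus d)} {δ Me MQ Mg : ℝ} (hMe : 0 ≤ Me) (hMQ : 0 ≤ MQ)
    (hMg : 0 ≤ Mg)
    (he : ∀ᵐ z ∂(volume.restrict (Icc (δ / 2) (T - δ / 2) ×ˢ univ)), |e z.1 z.2| ≤ Me)
    (hQ : ∀ᵐ z ∂(volume.restrict (Icc (δ / 2) (T - δ / 2) ×ˢ univ)), ‖Q z.1 z.2‖ ≤ MQ)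
    (hg : ∀ᵐ z ∂(volume.restrict (Icc (δ / 2) (T - δ / 2) ×ˢ univ)), |g z.1 z.2| ≤ Mg)
    (hμ : μ (Icc (δ / 2) (T - δ / 2) ×ˢ univ) < ∞)
    (hbal : ∀ ψ : ℝ → UnitAddTorus d → ℝ,
      FunctionSpaces.Torus.IsSpaceTimeTestIoo T ψ →
        ∫ t in Ioo 0 T, ∫ x,
          (e t x * FunctionSpaces.Torus.timeDeriv ψ t x +
            ⟪Q t x, FunctionSpaces.Torus.gradient (ψ t) x⟫_ℝ +
            g t x * ψ t x) = ∫ z, ψ z.1 z.2 ∂μ) :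
    ∃ C : ℝ, ∀ z ∈ Icc δ (T - δ) ×ˢ (univ : Set (UnitAddTorus d)), ∀ r : ℝ, 0 < r →
      r ≤ min (δ / 4) (1 / (8 * Fintype.card d)) →
        μ (closedBall z r) ≤ ENNReal.ofReal (C * r ^ Fintype.card d) := by
  obtain ⟨B, hB0, hB⟩ := exists_norm_fderiv_radialCutoff_two_mul_le (EuclideanSpace ℝ d)
  obtain ⟨B₁, hB₁0, hB₁⟩ := exists_norm_fderiv_radialCutoff_two_mul_le ℝ
  set c : ℕ := Fintype.card d with hc
  have hc1 : (1 : ℝ) ≤ c := by exact_mod_cast hd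
  have hcpos : (0 : ℝ) < c := by linarith
  -- the a.e. bounds in iterated form
  have hae : ∀ᵐ t ∂(volume.restrict (Icc (δ / 2) (T - δ / 2))),
      ∀ᵐ x ∂(volume : Measure (UnitAddTorus d)),
        |e t x| ≤ Me ∧ ‖Q t x‖ ≤ MQ ∧ |g t x| ≤ Mg := by
    have h2 : ∀ᵐ z ∂(volume.restrict (Icc (δ / 2) (T - δ / 2) ×ˢ (univ : Set (UnitAddTorus d)))),
        |e z.1 z.2| ≤ Me ∧ ‖Q z.1 z.2‖ ≤ MQ ∧ |g z.1 z.2| ≤ Mg := he.and (hQ.and hg)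
    have hpr := Measure.prod_restrict (μ := (volume : Measure ℝ))
      (ν := (volume : Measure (UnitAddTorus d))) (Icc (δ / 2) (T - δ / 2)) (univ : Set (UnitAddTorus d))
    rw [Measure.restrict_univ] at hpr
    rw [Measure.volume_eq_prod, ← hpr] at h2
    exact Measure.ae_ae_of_ae_prod h2
  set K₀ : ℝ := Me * B₁ + MQ * B + Mg with hK₀
  have hK₀nn : 0 ≤ K₀ := by positivity
  refine ⟨4 * K₀ * (4 * c) ^ c, ?_⟩
  rintro ⟨t₀, x₀⟩ hz r hr hrle
  obtain ⟨ht₀, -⟩ := mem_prod.1 hz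
  rw [mem_Icc] at ht₀
  have hrδ : r ≤ δ / 4 := hrle.trans (min_le_left _ _)
  have hrc : r ≤ 1 / (8 * c) := hrle.trans (min_le_right _ _)
  have hr0 : r ≠ 0 := hr.ne'
  -- the spatial scale `R = d r`
  set R : ℝ := c * r with hR
  have hRpos : 0 < R := mul_pos hcpos hr
  have hR8 : R ≤ 1 / 8 := by
    have h := mul_le_mul_of_nonneg_left hrc hcpos.le
    have h2 : (c : ℝ) * (1 / (8 * c)) = 1 / 8 := by field_simp
    rw [h2] at h
    exact h
  have hrR : r ≤ R := le_mul_of_one_le_left hr.le hc1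
  have hr1 : r ≤ 1 := by linarith
  have h0t : 2 * r < t₀ := by linarith [ht₀.1]
  have hTt : t₀ + 2 * r < T := by linarith [ht₀.2]
  have hS : Icc (t₀ - 2 * r) (t₀ + 2 * r) ⊆ Ioo 0 T := fun t ht => ⟨by linarith [ht.1], by linarith [ht.2]⟩
  have hS' : Icc (t₀ - 2 * r) (t₀ + 2 * r) ⊆ Icc (δ / 2) (T - δ / 2) := fun t ht =>
    ⟨by linarith [ht.1, ht₀.1], by linarith [ht.2, ht₀.2]⟩
  -- the cutoffs
  set Θ : UnitAddTorus d → ℝ :=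
    FunctionSpaces.Torus.transplant (radialCutoff R (2 * R) : EuclideanSpace ℝ d → ℝ) with hΘ
  set η : ℝ → ℝ := fun t => radialCutoff r (2 * r) (t - t₀) with hη
  set ψ : ℝ → UnitAddTorus d → ℝ := fun t y => η t * Θ (x₀ - y) with hψ
  have hΘs : FunctionSpaces.Torus.IsSmooth Θ := isSmooth_transplant_radialCutoff hRpos hR8
  have hΘ1 : FunctionSpaces.Torus.IsContDiff 1 Θ := hΘs.isContDiff (by simp)
  have hψtest : FunctionSpaces.Torus.IsSpaceTimeTestIoo T ψ :=
    isSpaceTimeTestIoo_radialCutoff_mul_comp_sub hr h0t hTt hΘs x₀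
  have hderiv : ∀ t y, FunctionSpaces.Torus.timeDeriv ψ t y = deriv η t * Θ (x₀ - y) :=
    fun t y => Torus.timeDeriv_mul_comp_sub η Θ x₀ t y
  have hgrad : ∀ t y, FunctionSpaces.Torus.gradient (ψ t) y =
      -(η t • FunctionSpaces.Torus.gradient Θ (x₀ - y)) :=
    fun t y => Torus.gradient_mul_comp_sub hΘ1 x₀ t y
  have hη01 : ∀ t, 0 ≤ η t ∧ η t ≤ 1 := fun t => ⟨radialCutoff_nonneg _ _ _, radialCutoff_le_one _ _ _⟩
  have hΘ01 : ∀ z, 0 ≤ Θ z ∧ Θ z ≤ 1 := fun z => ⟨radialCutoff_nonneg _ _ _, radialCutoff_le_one _ _ _⟩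
  have hηabs : ∀ t, |η t| ≤ 1 := fun t => by
    rw [abs_of_nonneg (hη01 t).1]
    exact (hη01 t).2
  have hΘabs : ∀ z, |Θ z| ≤ 1 := fun z => by
    rw [abs_of_nonneg (hΘ01 z).1]
    exact (hΘ01 z).2
  have hψ01 : ∀ t y, 0 ≤ ψ t y ∧ ψ t y ≤ 1 := fun t y =>
    ⟨mul_nonneg (hη01 t).1 (hΘ01 _).1, mul_le_one₀ (hη01 t).2 (hΘ01 _).1 (hΘ01 _).2⟩
  have hψabs : ∀ t y, |ψ t y| ≤ 1 := fun t y => by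
    rw [abs_of_nonneg (hψ01 t y).1]
    exact (hψ01 t y).2
  have hB₁' : ∀ t, |deriv η t| ≤ B₁ / r := abs_deriv_radialCutoff_sub_le (hB₁ r hr)
  have hgradΘ : ∀ z, ‖FunctionSpaces.Torus.gradient Θ z‖ ≤ B / R :=
    norm_gradient_transplant_radialCutoff_le hRpos hR8 (hB R hRpos)
  -- the integrand of the balance `∂ₜ e + div Q + μ = g` tested with `ψ`
  set F : ℝ → UnitAddTorus d → ℝ := fun t x =>
    e t x * FunctionSpaces.Torus.timeDeriv ψ t x +
      ⟪Q t x, FunctionSpaces.Torus.gradient (ψ t) x⟫_ℝ + g t x * ψ t x with hF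
  have hid : ∫ t in Ioo 0 T, ∫ x, F t x = ∫ z, ψ z.1 z.2 ∂μ := hbal ψ hψtest
  -- localisation of the integrand
  have hF0_time : ∀ t, 2 * r < |t - t₀| → ∀ x, F t x = 0 := by
    intro t ht x
    have h1 : η t = 0 := radialCutoff_sub_eq_zero hr ht.le
    have h2 : deriv η t = 0 := deriv_radialCutoff_sub_eq_zero hr ht
    have h3 : ψ t x = 0 := by
      show η t * Θ (x₀ - x) = 0
      rw [h1, zero_mul]
    simp only [hF, hderiv t x, hgrad t x, h1, h2, h3, zero_mul, zero_smul, neg_zero,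
      inner_zero_right, mul_zero, add_zero]
  have hF0_space : ∀ t x, 2 * R < ‖x₀ - x‖ → F t x = 0 := by
    intro t x hx
    have h1 : Θ (x₀ - x) = 0 := transplant_radialCutoff_eq_zero hRpos hx
    have h2 : FunctionSpaces.Torus.gradient Θ (x₀ - x) = 0 :=
      gradient_transplant_radialCutoff_eq_zero hRpos hR8 hx
    have h3 : ψ t x = 0 := by
      show η t * Θ (x₀ - x) = 0
      rw [h1, mul_zero]
    simp only [hF, hderiv t x, hgrad t x, h1, h2, h3, mul_zero, smul_zero, neg_zero,
      inner_zero_right, add_zero]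
  -- the pointwise bound where `e`, `Q`, `g` are bounded
  have hFbd : ∀ t x, |e t x| ≤ Me → ‖Q t x‖ ≤ MQ → |g t x| ≤ Mg → ‖F t x‖ ≤ K₀ / r := by
    intro t x hex hQx hgx
    have hdt : |FunctionSpaces.Torus.timeDeriv ψ t x| ≤ B₁ / r := by
      rw [hderiv, abs_mul]
      calc |deriv η t| * |Θ (x₀ - x)| ≤ B₁ / r * 1 :=
            mul_le_mul (hB₁' t) (hΘabs _) (abs_nonneg _) (by positivity)
        _ = B₁ / r := mul_one _
    have hgr : ‖FunctionSpaces.Torus.gradient (ψ t) x‖ ≤ B / r := by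
      rw [hgrad, norm_neg, norm_smul, Real.norm_eq_abs]
      calc |η t| * ‖FunctionSpaces.Torus.gradient Θ (x₀ - x)‖ ≤ 1 * (B / R) :=
            mul_le_mul (hηabs t) (hgradΘ _) (norm_nonneg _) zero_le_one
        _ = B / R := one_mul _
        _ ≤ B / r := div_le_div_of_nonneg_left hB0 hr hrR
    have h1 : |e t x * FunctionSpaces.Torus.timeDeriv ψ t x| ≤ Me * (B₁ / r) := by
      rw [abs_mul]
      exact mul_le_mul hex hdt (abs_nonneg _) hMe
    have h2 : |⟪Q t x, FunctionSpaces.Torus.gradient (ψ t) x⟫_ℝ| ≤ MQ * (B / r) :=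
      (abs_real_inner_le_norm _ _).trans (mul_le_mul hQx hgr (norm_nonneg _) hMQ)
    have h3 : |g t x * ψ t x| ≤ Mg / r := by
      rw [abs_mul]
      calc |g t x| * |ψ t x| ≤ Mg * 1 := mul_le_mul hgx (hψabs t x) (abs_nonneg _) hMg
        _ = Mg := mul_one _
        _ ≤ Mg / r := le_div_self hMg hr hr1
    rw [Real.norm_eq_abs]
    calc |F t x| ≤ |e t x * FunctionSpaces.Torus.timeDeriv ψ t x +
          ⟪Q t x, FunctionSpaces.Torus.gradient (ψ t) x⟫_ℝ| + |g t x * ψ t x| := abs_add_le _ _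
      _ ≤ (|e t x * FunctionSpaces.Torus.timeDeriv ψ t x| +
          |⟪Q t x, FunctionSpaces.Torus.gradient (ψ t) x⟫_ℝ|) + |g t x * ψ t x| := by
          gcongr
          exact abs_add_le _ _
      _ ≤ (Me * (B₁ / r) + MQ * (B / r)) + Mg / r := add_le_add (add_le_add h1 h2) h3
      _ = K₀ / r := by
          rw [hK₀]
          ring
  -- the space integral at a time where the bounds hold
  have hinner : ∀ t, (∀ᵐ x ∂(volume : Measure (UnitAddTorus d)),
      |e t x| ≤ Me ∧ ‖Q t x‖ ≤ MQ ∧ |g t x| ≤ Mg) →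
      ‖∫ x, F t x‖ ≤ K₀ / r * (4 * R) ^ c := by
    intro t ht
    have hvan : ∀ x, x ∉ closedBall x₀ (2 * R) → F t x = 0 := fun x hx =>
      hF0_space t x (by rwa [mem_closedBall, not_le, dist_comm, dist_eq_norm] at hx)
    rw [← setIntegral_eq_integral_of_forall_compl_eq_zero hvan]
    calc ‖∫ x in closedBall x₀ (2 * R), F t x‖ ≤ K₀ / r * volume.real (closedBall x₀ (2 * R)) :=
          norm_setIntegral_le_of_norm_le_const_ae (measure_lt_top _ _)
            (ae_restrict_of_ae (ht.mono fun x hx => hFbd t x hx.1 hx.2.1 hx.2.2))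
      _ ≤ K₀ / r * (2 * (2 * R)) ^ c :=
          mul_le_mul_of_nonneg_left (volume_real_closedBall_unitAddTorus_le x₀ (by positivity))
            (by positivity)
      _ = K₀ / r * (4 * R) ^ c := by ring
  -- the space–time integral
  have htime : ∫ t in Ioo 0 T, ∫ x, F t x = ∫ t in Icc (t₀ - 2 * r) (t₀ + 2 * r), ∫ x, F t x := by
    refine setIntegral_eq_of_subset_of_forall_sdiff_eq_zero measurableSet_Ioo hS fun t ht => ?_
    have h2 : 2 * r < |t - t₀| := by
      have h' : t ∉ Icc (t₀ - 2 * r) (t₀ + 2 * r) := ht.2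
      rw [mem_Icc, not_and_or, not_le, not_le] at h'
      rcases h' with h' | h'
      · rw [abs_of_neg (by linarith)]
        linarith
      · rw [abs_of_pos (by linarith)]
        linarith
    simp only [hF0_time t h2, integral_zero]
  have hup : ∫ t in Ioo 0 T, ∫ x, F t x ≤ 4 * K₀ * (4 * c) ^ c * r ^ c := by
    rw [htime]
    calc ∫ t in Icc (t₀ - 2 * r) (t₀ + 2 * r), ∫ x, F t x
        ≤ ‖∫ t in Icc (t₀ - 2 * r) (t₀ + 2 * r), ∫ x, F t x‖ := Real.le_norm_self _
      _ ≤ K₀ / r * (4 * R) ^ c * volume.real (Icc (t₀ - 2 * r) (t₀ + 2 * r)) :=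
          norm_setIntegral_le_of_norm_le_const_ae measure_Icc_lt_top
            ((ae_restrict_of_ae_restrict_of_subset hS' hae).mono fun t ht => hinner t ht)
      _ = 4 * K₀ * (4 * c) ^ c * r ^ c := by
          rw [Real.volume_real_Icc_of_le (by linarith), hR]
          field_simp
          ring
  -- `μ ≥ 0` and `ψ = 1` on the ball: the lower bound
  have hcont : Continuous fun z : ℝ × UnitAddTorus d => ψ z.1 z.2 :=
    continuous_radialCutoff_mul_comp_sub r t₀ hΘs.continuous x₀
  have hsupp : support (fun z : ℝ × UnitAddTorus d => ψ z.1 z.2) ⊆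
      Icc (δ / 2) (T - δ / 2) ×ˢ univ := by
    intro z hz
    refine ⟨hS' ?_, mem_univ _⟩
    have hne : η z.1 ≠ 0 := fun h => hz (by
      show η z.1 * Θ (x₀ - z.2) = 0
      rw [h, zero_mul])
    exact support_radialCutoff_sub_subset hr hne
  have hint : Integrable (fun z : ℝ × UnitAddTorus d => ψ z.1 z.2) μ := by
    refine (integrableOn_iff_integrable_of_support_subset hsupp).1 ?_
    exact Measure.integrableOn_of_bounded (M := 1) hμ.ne hcont.aestronglyMeasurable
      (ae_of_all _ fun z => by
        rw [Real.norm_eq_abs, abs_of_nonneg (hψ01 _ _).1]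
        exact (hψ01 _ _).2)
  have hball_one : ∀ z ∈ closedBall ((t₀, x₀) : ℝ × UnitAddTorus d) r, ψ z.1 z.2 = 1 := by
    rintro ⟨t, y⟩ hzb
    rw [mem_closedBall, Prod.dist_eq, max_le_iff] at hzb
    obtain ⟨ht, hy⟩ := hzb
    show η t * Θ (x₀ - y) = 1
    have h1 : η t = 1 := radialCutoff_sub_eq_one hr (by rwa [← Real.dist_eq])
    have h2 : Θ (x₀ - y) = 1 := by
      refine transplant_radialCutoff_eq_one hRpos ?_
      rw [← dist_eq_norm, dist_comm]
      exact mul_le_mul_of_nonneg_left hy hcpos.le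
    rw [h1, h2, one_mul]
  have hlow : μ.real (closedBall ((t₀, x₀) : ℝ × UnitAddTorus d) r) ≤ ∫ z, ψ z.1 z.2 ∂μ := by
    calc μ.real (closedBall ((t₀, x₀) : ℝ × UnitAddTorus d) r)
        = ∫ z, (closedBall ((t₀, x₀) : ℝ × UnitAddTorus d) r).indicator (fun _ => (1 : ℝ)) z ∂μ := by
          rw [integral_indicator_const (1 : ℝ) measurableSet_closedBall, smul_eq_mul, mul_one]
      _ ≤ ∫ z, ψ z.1 z.2 ∂μ := by
          refine integral_mono_of_nonneg (ae_of_all _ fun z => ?_) hint (ae_of_all _ fun z => ?_)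
          · exact Set.indicator_nonneg (fun _ _ => zero_le_one) _
          · show (closedBall ((t₀, x₀) : ℝ × UnitAddTorus d) r).indicator (fun _ => (1 : ℝ)) z ≤
              ψ z.1 z.2
            by_cases hzb : z ∈ closedBall ((t₀, x₀) : ℝ × UnitAddTorus d) r
            · rw [indicator_of_mem hzb, hball_one z hzb]
            · rw [indicator_of_notMem hzb]
              exact (hψ01 _ _).1
  -- conclusion
  have hballsub : closedBall ((t₀, x₀) : ℝ × UnitAddTorus d) r ⊆ Icc (δ / 2) (T - δ / 2) ×ˢ univ := by
    rintro ⟨t, y⟩ hzb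
    rw [mem_closedBall, Prod.dist_eq, max_le_iff, Real.dist_eq] at hzb
    have ht := abs_le.1 hzb.1
    exact ⟨⟨by linarith [ht.1, ht₀.1], by linarith [ht.2, ht₀.2]⟩, mem_univ _⟩
  have hfin : μ (closedBall ((t₀, x₀) : ℝ × UnitAddTorus d) r) ≠ ∞ :=
    (lt_of_le_of_lt (measure_mono hballsub) hμ).ne
  calc μ (closedBall ((t₀, x₀) : ℝ × UnitAddTorus d) r)
      = ENNReal.ofReal (μ.real (closedBall ((t₀, x₀) : ℝ × UnitAddTorus d) r)) := by
        rw [measureReal_def, ENNReal.ofReal_toReal hfin]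
    _ ≤ ENNReal.ofReal (4 * K₀ * (4 * c) ^ c * r ^ c) :=
        ENNReal.ofReal_le_ofReal (hlow.trans (hid.symm.le.trans hup))

/-- **Discharge of `DeRosaDrivasInversi2024_thm19_bounded`** (De Rosa–Drivas–Inversi, J. Math.
Fluid Mech. 26 (2024), arXiv:2301.09603, Thm. 1.9 — general conservation laws — in the bounded
case `r = ∞`: "for `r = ∞` we have `D ≪ H^d`", with the bounded source term of App. B, (B.1)
with `l = m = ∞`, on `Ω = T^d`): if `e`, `Q`, `g` are essentially bounded on every
`[δ, T-δ] × T^d` and `∂ₜ e + div Q + μ = g` in `𝒟'((0,T) × T^d)` for a non-negative measure `μ`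
finite on every `[δ, T-δ] × T^d`, then the restriction of `μ` to the open slab `(0,T) × T^d` is
absolutely continuous with respect to the `d`-dimensional Hausdorff measure of the space–time
`ℝ × T^d`. Proof: the cylinder estimate `cylinder_estimate_div` (op. cit. Prop. 3.2 / Rem. 2.7)
on each window `[δ, T-δ]`, the covering lemma
`absolutelyContinuous_restrict_hausdorffMeasure_of_closedBall_le` (op. cit. Lemma 2.3), and
exhaustion of `(0, T)` by the windows `[1/(n+1), T - 1/(n+1)]`. The joint measurability
hypotheses of the fact are not needed by the argument. [cite: DeRosaDrivasInversi2024, Thm. 1.9 and App. B] -/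
theorem DeRosaDrivasInversi2024_thm19_bounded_holds : DeRosaDrivasInversi2024_thm19_bounded := by
  intro d _ _ hd T e Q g _ _ _ he hQ hg μ hμ hbal
  have hcpos : (0 : ℝ) < Fintype.card d := by exact_mod_cast lt_of_lt_of_le zero_lt_one hd
  -- each closed time window
  have hslab : ∀ δ : ℝ, 0 < δ →
      μ.restrict (Icc δ (T - δ) ×ˢ univ) ≪ μH[Fintype.card d] := by
    intro δ hδ
    obtain ⟨Me, hMe⟩ := he (δ / 2) (half_pos hδ)
    obtain ⟨MQ, hMQ⟩ := hQ (δ / 2) (half_pos hδ)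
    obtain ⟨Mg, hMg⟩ := hg (δ / 2) (half_pos hδ)
    have hMe' : ∀ᵐ z ∂(volume.restrict (Icc (δ / 2) (T - δ / 2) ×ˢ univ)),
        |e z.1 z.2| ≤ max Me 0 := hMe.mono fun z hz => hz.trans (le_max_left _ _)
    have hMQ' : ∀ᵐ z ∂(volume.restrict (Icc (δ / 2) (T - δ / 2) ×ˢ univ)),
        ‖Q z.1 z.2‖ ≤ max MQ 0 := hMQ.mono fun z hz => hz.trans (le_max_left _ _)
    have hMg' : ∀ᵐ z ∂(volume.restrict (Icc (δ / 2) (T - δ / 2) ×ˢ univ)),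
        |g z.1 z.2| ≤ max Mg 0 := hMg.mono fun z hz => hz.trans (le_max_left _ _)
    obtain ⟨C, hC⟩ := cylinder_estimate_div hd (le_max_right _ _) (le_max_right _ _)
      (le_max_right _ _) hMe' hMQ' hMg' (hμ _ (half_pos hδ)) hbal
    have hr₀ : 0 < min (δ / 4) (1 / (8 * (Fintype.card d : ℝ))) :=
      lt_min (by positivity) (by positivity)
    refine Literature.MeasureTheory.Hausdorff.absolutelyContinuous_restrict_hausdorffMeasure_of_closedBall_le
      μ (measurableSet_Icc.prod MeasurableSet.univ) hcpos (C := C) hr₀ fun z hz r hr hrr => ?_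
    rw [Real.rpow_natCast]
    exact hC z hz r hr hrr
  -- exhaustion of the open slab by closed windows
  refine Measure.AbsolutelyContinuous.mk fun s hs h0 => ?_
  have hcover : Ioo 0 T ×ˢ (univ : Set (UnitAddTorus d)) ⊆
      ⋃ n : ℕ, Icc (1 / ((n : ℝ) + 1)) (T - 1 / ((n : ℝ) + 1)) ×ˢ univ := by
    rintro ⟨t, x⟩ ⟨⟨ht0, htT⟩, -⟩
    have hm : 0 < min t (T - t) := lt_min ht0 (by linarith)
    obtain ⟨n, hn⟩ := exists_nat_one_div_lt hm
    exact mem_iUnion.2 ⟨n, ⟨(hn.le.trans (min_le_left _ _)),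
      by linarith [hn.le.trans (min_le_right _ _)]⟩, mem_univ _⟩
  refine nonpos_iff_eq_zero.1 ?_
  calc μ.restrict (Ioo 0 T ×ˢ univ) s = μ (s ∩ Ioo 0 T ×ˢ univ) := Measure.restrict_apply hs
    _ ≤ μ (⋃ n : ℕ, s ∩ Icc (1 / ((n : ℝ) + 1)) (T - 1 / ((n : ℝ) + 1)) ×ˢ univ) := by
        refine measure_mono ?_
        rw [← inter_iUnion]
        exact inter_subset_inter_right _ hcover
    _ ≤ ∑' n : ℕ, μ (s ∩ Icc (1 / ((n : ℝ) + 1)) (T - 1 / ((n : ℝ) + 1)) ×ˢ univ) :=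
        measure_iUnion_le _
    _ = 0 := by
        refine ENNReal.tsum_eq_zero.2 fun n => ?_
        rw [← Measure.restrict_apply hs]
        exact hslab _ (by positivity) h0
    _ ≤ 0 := le_rfl

end Literature.Barriers.AnomalousDissipation
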